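import Summits.BirchSwinnertonDyer.Rank1Residual.P2.PrintCf2SplitBadTwoReadTwoCut
import Literature.NumberTheory.EllipticCurves.PAdicOneVariableSupportOfColemanTraceTwo
import Literature.NumberTheory.GaloisRepresentations.LubinTateComparisonAddPoints
import Literature.NumberTheory.GaloisRepresentations.LubinTateColemanRelativeInterpolationTwo
import HarnessLib

set_option autoImplicit false

/-!
# READ₂ cut, tree-currency half: the reading witness of a series `≡ 1 (mod 2)` is `Λ₂` of an INTEGRAL series, so its value
# at `z ∈ 𝔪_ℂ` is an `evS`-value (R221 «EVAL₂» CLOSED)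

Cell `bsd-print-cf2`, typer `bsd-print-cf2-ty2` g45 (literature-prover seat; typer directory `Rank1Residual/P2/`, Theses-free, no
item): port P50 (part 2 of 2) of STUB-PLAN `stub_heegnerIndexLowerAtTwo` (crux `PrintCf2.SplitBadTwoLowerHalfOfFacts`,
stmt-BirchSwinnertonDyer-27851; CRITIC-ROWS-g41 row 117; sketch k3-g40 `2333f3139e2b61f4` §3 VERBATIM; its §4 = the LOCAL-UNTWIST₂
value half is ported with k3-g41 in the sibling `PrintCf2SplitBadTwoLocalUntwist`). HONEST FRAMING: nothing here proves BSD, the crux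
or the stub; no named fact, no new definition, no `sorry`.

* §3 (tree evaluation): `tsum_coeff_subst_mul_pow_eq`, `tsum_coeff_map_subst_mul_pow_eq`, `norm_one_sub_evS_lt_one`,
  `evS_sq_eq_of_factorisation`, `lambda_value_split_evS`, `lambda_value_refl_evS`, ★ `read_value_eq_tsum_lamTerm`.

References: [deShalit1987] I.3.3 (7)–(8) (p. 17), I.3.5 (11), I.3.7 (14)–(15), I.3.12–3.13; [LubinTate1965] (16)–(18).
-/

noncomputable section

open scoped PowerSeries.WithPiTopology

namespace Summit.BirchSwinnertonDyer.Rank1Residual.P2.ReadTwoCut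

/-! ## §3. The series side meets the value side in the TREE's currency (PROVED): values of composites / of integral
series at points of `𝔪_{ℂ_F}` are `evS`-values (`tsum_coeff_mul_pow_eq_evS`, `hasSum_map_coeff_mul_pow`) and
`evS` is an algebra hom commuting with substitution (`evS_subst`) — so "value of `Λ₂∘y∘ϑ` at `z`" = `Λ₂(y(ϑ(z)))`
and the congruence `g² = (g^φ∘f)(1+2y)` EVALUATES.  No analytic input. -/

section TreeEvaluation

open ValuativeRel IsLocalRing Field
open Literature.NumberTheory.GaloisRepresentations Literature.NumberTheory.GaloisRepresentations.IsNonarchimedeanLocalField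
  Literature.NumberTheory.GaloisRepresentations.LubinTate Literature.NumberTheory.PAdicHodge
  Literature.NumberTheory.EllipticCurves

variable {F : Type} [Field F] [ValuativeRel F] [TopologicalSpace F] [IsNonarchimedeanLocalField F]

attribute [local instance] ltNormUniformSpace ltNormIsUniformAddGroup rk1 nF nE fintypeResidueField

/-- ★ **SUBST–EVAL at a point of `𝔪_ℂ`, in `ℂ_F`**: the value of `R ∘ φ` at `z` is the value of `R` at `φ(z)`. -/
theorem tsum_coeff_subst_mul_pow_eq (R φ : PowerSeries (CBall F)) (hφ : PowerSeries.constantCoeff φ = 0)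
    (z : (maxNilIdealC F).toIdeal) :
    ∑' m : ℕ, ((PowerSeries.coeff m (PowerSeries.subst φ R) : CBall F) : CompletedAlgClosure F) *
        ((z : CBall F) : CompletedAlgClosure F) ^ m =
      ∑' d : ℕ, ((PowerSeries.coeff d R : CBall F) : CompletedAlgClosure F) *
        ((evS (maxNilIdealC F) z φ : CBall F) : CompletedAlgClosure F) ^ d := by
  have h := tsum_coeff_mul_pow_eq_evS R ⟨evS (maxNilIdealC F) z φ, evS_mem_of_constantCoeff_eq_zero _ z hφ⟩
  rw [tsum_coeff_mul_pow_eq_evS, evS_subst (maxNilIdealC F) z hφ R]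
  exact h.symm

/-- ★ the same pushed along `θ : ℂ_F → ℂ_2` (the currency of `prints_family_def_two`). -/
theorem tsum_coeff_map_subst_mul_pow_eq (θ : CompletedAlgClosure F →+* ℂ_[2]) (hθc : Continuous θ)
    (R φ : PowerSeries (CBall F)) (hφ : PowerSeries.constantCoeff φ = 0) (z : (maxNilIdealC F).toIdeal) :
    ∑' m : ℕ, PowerSeries.coeff m (PowerSeries.map (θ.comp (CBall F).subtype) (PowerSeries.subst φ R)) *
        (θ ((z : CBall F) : CompletedAlgClosure F)) ^ m =
      ∑' d : ℕ, PowerSeries.coeff d (PowerSeries.map (θ.comp (CBall F).subtype) R) *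
        (θ ((evS (maxNilIdealC F) z φ : CBall F) : CompletedAlgClosure F)) ^ d := by
  have h := (hasSum_map_coeff_mul_pow θ hθc R
    ⟨evS (maxNilIdealC F) z φ, evS_mem_of_constantCoeff_eq_zero _ z hφ⟩).tsum_eq
  rw [(hasSum_map_coeff_mul_pow θ hθc _ z).tsum_eq, evS_subst (maxNilIdealC F) z hφ R]
  exact h.symm

/-- Values of a principal series (`g(0) = 1`) at points of `𝔪_ℂ` are principal units of `ℂ_F`. -/
theorem norm_one_sub_evS_lt_one (g : PowerSeries (CBall F)) (hg : PowerSeries.constantCoeff g = 1)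
    (z : (maxNilIdealC F).toIdeal) :
    ‖(1 : CompletedAlgClosure F) - ((evS (maxNilIdealC F) z g : CBall F) : CompletedAlgClosure F)‖ < 1 := by
  have h0 : PowerSeries.constantCoeff (g - 1) = 0 := by rw [map_sub, hg, map_one, sub_self]
  have hmem : evS (maxNilIdealC F) z (g - 1) ∈ (maxNilIdealC F).toIdeal :=
    evS_mem_of_constantCoeff_eq_zero _ z h0
  have hlt : ‖((evS (maxNilIdealC F) z (g - 1) : CBall F) : CompletedAlgClosure F)‖ < 1 := hmem
  have hval : ((evS (maxNilIdealC F) z g : CBall F) : CompletedAlgClosure F) =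
      1 + ((evS (maxNilIdealC F) z (g - 1) : CBall F) : CompletedAlgClosure F) := by
    rw [map_sub, map_one]; push_cast; ring
  rw [hval, sub_add_cancel_left, norm_neg]
  exact hlt

/-- The congruence datum EVALUATES: `g² = G·(1 + 2y)` in `𝒪_ℂ⟦X⟧` ⟹ `g(z)² = G(z)·(1 + 2·y(z))`. -/
theorem evS_sq_eq_of_factorisation {g G y : PowerSeries (CBall F)}
    (h : g ^ 2 = G * (1 + PowerSeries.C (2 : CBall F) * y)) (z : (maxNilIdealC F).toIdeal) :
    (evS (maxNilIdealC F) z g) ^ 2 = evS (maxNilIdealC F) z G * (1 + 2 * evS (maxNilIdealC F) z y) := by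
  have := congrArg (evS (maxNilIdealC F) z) h
  simpa [map_pow, map_mul, map_add, map_one, evS_C] using this

/-- ★ **S4 ASSEMBLED IN THE TREE'S CURRENCY** (composite of §2 and §3): for principal `g, G ∈ 𝒪_ℂ⟦X⟧`, integral `y`
with `g² = G(1+2y)`, points `w` of `𝔪_ℂ`, and `θ : ℂ_F → ℂ_2` continuous, of norm `≤ 1` on `𝒪_ℂ` and mapping `𝔪_ℂ`
into the open unit ball (all three hold for the `θ` of record, `norm_equivPadicComplex_lt_one_iff`):
the value `Σ' lamTerm (θ y(w))` IS `plog θ(g(w)) − ½ plog θ(G(w))`. -/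
theorem lambda_value_split_evS (θ : CompletedAlgClosure F →+* ℂ_[2])
    (hθ1 : ∀ z : CBall F, ‖θ (z : CompletedAlgClosure F)‖ ≤ 1)
    (hθlt : ∀ x : CompletedAlgClosure F, ‖x‖ < 1 → ‖θ x‖ < 1)
    {g G y : PowerSeries (CBall F)} (hg : PowerSeries.constantCoeff g = 1) (hG : PowerSeries.constantCoeff G = 1)
    (h : g ^ 2 = G * (1 + PowerSeries.C (2 : CBall F) * y)) (w : (maxNilIdealC F).toIdeal) :
    ∑' d, lamTerm (θ ((evS (maxNilIdealC F) w y : CBall F) : CompletedAlgClosure F)) d =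
      Literature.NumberTheory.Transcendental.PadicExp.plog
          (θ ((evS (maxNilIdealC F) w g : CBall F) : CompletedAlgClosure F)) -
        (2 : ℂ_[2])⁻¹ * Literature.NumberTheory.Transcendental.PadicExp.plog
          (θ ((evS (maxNilIdealC F) w G : CBall F) : CompletedAlgClosure F)) := by
  have hx : ‖1 - θ ((evS (maxNilIdealC F) w g : CBall F) : CompletedAlgClosure F)‖ < 1 := by
    rw [← map_one θ, ← map_sub]; exact hθlt _ (norm_one_sub_evS_lt_one g hg w)
  have hy : ‖1 - θ ((evS (maxNilIdealC F) w G : CBall F) : CompletedAlgClosure F)‖ < 1 := by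
    rw [← map_one θ, ← map_sub]; exact hθlt _ (norm_one_sub_evS_lt_one G hG w)
  have ht : ‖θ ((evS (maxNilIdealC F) w y : CBall F) : CompletedAlgClosure F)‖ ≤ 1 := hθ1 _
  have hfac := congrArg (fun s : CBall F => θ (s : CompletedAlgClosure F)) (evS_sq_eq_of_factorisation h w)
  simp only [Subring.coe_mul, SubmonoidClass.coe_pow, Subring.coe_add, Subring.coe_one, map_mul, map_pow,
    map_add, map_one] at hfac
  have h2 : θ (((2 : CBall F) : CBall F) : CompletedAlgClosure F) = 2 := by
    rw [show (((2 : CBall F) : CBall F) : CompletedAlgClosure F) = 2 by norm_cast, map_ofNat]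
  rw [h2] at hfac
  exact lambda_value_split hx hy ht hfac (summable_lamTerm ht).hasSum

/-- ★ **S4 (REFL presentation of record) IN THE TREE'S CURRENCY**: for `P = 1 + 2y ∈ 𝒪_ℂ⟦X⟧` (`P =` the reflection
quotient `Q_β = g_β/τ_E g_β` normalised to `Q(0) = 1`; `Q_β ≡ 1 (mod π')` is k3-g39's PROVED `reflQuot_sub_one_mem` /
`transportedCongruence_holds`) and `w ∈ 𝔪_ℂ`: `Σ' lamTerm (θ y(w)) = ½·plog θ(P(w))`.  With `tsum_coeff_map_subst_mul_pow_eq`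
this is R221 «EVAL₂» for the witness `½·logOf P = Λ₂(y)` (`logOf_one_add_two_smul`, §5): NO `logOf`-evaluation API. -/
theorem lambda_value_refl_evS (θ : CompletedAlgClosure F →+* ℂ_[2])
    (hθ1 : ∀ z : CBall F, ‖θ (z : CompletedAlgClosure F)‖ ≤ 1)
    {P y : PowerSeries (CBall F)} (hP : P = 1 + PowerSeries.C (2 : CBall F) * y) (w : (maxNilIdealC F).toIdeal) :
    ∑' d, lamTerm (θ ((evS (maxNilIdealC F) w y : CBall F) : CompletedAlgClosure F)) d =
      (2 : ℂ_[2])⁻¹ * Literature.NumberTheory.Transcendental.PadicExp.plog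
          (θ ((evS (maxNilIdealC F) w P : CBall F) : CompletedAlgClosure F)) := by
  have ht : ‖θ ((evS (maxNilIdealC F) w y : CBall F) : CompletedAlgClosure F)‖ ≤ 1 := hθ1 _
  have hev : evS (maxNilIdealC F) w P = 1 + 2 * evS (maxNilIdealC F) w y := by
    have := congrArg (evS (maxNilIdealC F) w) hP
    simpa [map_mul, map_add, map_one, evS_C] using this
  have hfac := congrArg (fun s : CBall F => θ (s : CompletedAlgClosure F)) hev
  simp only [Subring.coe_mul, Subring.coe_add, Subring.coe_one, map_mul, map_add, map_one] at hfac
  have h2 : θ (((2 : CBall F) : CBall F) : CompletedAlgClosure F) = 2 := by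
    rw [show (((2 : CBall F) : CBall F) : CompletedAlgClosure F) = 2 by norm_cast, map_ofNat]
  rw [h2] at hfac
  exact lambda_value_refl ht hfac

/-- ★★ **R221 «EVAL₂» — THE VALUE OF THE READING WITNESS, CLOSED IN KERNEL.**  For any `L ∈ 𝒪_ℂ⟦X⟧` whose
`θ`-coefficients are the `Λ₂` scalars (`θ[X⁰]L = 0`, `θ[X^{d+1}]L = (−1)^d 2^d/(d+1)`; existence: `coeff_Lam2_succ` + the
integrality `‖2^d/(d+1)‖₂ ≤ 1` of `norm_lamTerm_le`) and any `y ∈ 𝒪_ℂ⟦X⟧` with `y(0) = 0`, the `θ`-value at `z ∈ 𝔪_ℂ` of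
the composite `L∘y` (the series the reading actually evaluates, after `∘ϑ` which is one more `tsum_coeff_map_subst_mul_pow_eq`)
is `Σ' lamTerm (θ y(z))` — hence `½·plog θ P(z)` (REFL, `lambda_value_refl_evS`) or `plog θ g(z) − ½·plog θ G(z)` (FROB,
`lambda_value_split_evS`).  Ingredients: tree `evS_subst`, `hasSum_map_coeff_mul_pow`; one reindexing.  No `logOf`-evaluation
theorem, no radius-of-convergence bookkeeping. -/
theorem read_value_eq_tsum_lamTerm (θ : CompletedAlgClosure F →+* ℂ_[2]) (hθc : Continuous θ)
    (L y : PowerSeries (CBall F)) (hy : PowerSeries.constantCoeff y = 0)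
    (hL0 : θ ((PowerSeries.coeff 0 L : CBall F) : CompletedAlgClosure F) = 0)
    (hL : ∀ d : ℕ, θ ((PowerSeries.coeff (d + 1) L : CBall F) : CompletedAlgClosure F) =
      (-1) ^ d * (2 : ℂ_[2]) ^ d / ((d : ℂ_[2]) + 1))
    (z : (maxNilIdealC F).toIdeal) :
    ∑' m : ℕ, PowerSeries.coeff m (PowerSeries.map (θ.comp (CBall F).subtype) (PowerSeries.subst y L)) *
        (θ ((z : CBall F) : CompletedAlgClosure F)) ^ m =
      ∑' d : ℕ, lamTerm (θ ((evS (maxNilIdealC F) z y : CBall F) : CompletedAlgClosure F)) d := by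
  rw [tsum_coeff_map_subst_mul_pow_eq θ hθc L y hy z]
  have hs := (hasSum_map_coeff_mul_pow θ hθc L
    ⟨evS (maxNilIdealC F) z y, evS_mem_of_constantCoeff_eq_zero _ z hy⟩).summable
  rw [hs.tsum_eq_zero_add]
  simp only [PowerSeries.coeff_map, RingHom.coe_comp, Function.comp_apply, Subring.coe_subtype]
  rw [hL0, zero_mul, zero_add]
  refine tsum_congr fun d => ?_
  rw [hL d, lamTerm]

end TreeEvaluation

end Summit.BirchSwinnertonDyer.Rank1Residual.P2.ReadTwoCut

end
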